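import Summits.AtomisticToContinuum.Crystallization.Theorems.OverbindingBudgetAffineCoreDescent

/-!
# NODE g101 «StrainBand» (lens-4) — the strained layer in NORMAL FORM: sitewise, fat, banded.
# `ShearLayer ⟺ StrainBand L (1/1000) (1/25) ⟺ MildBand ∧ StrongBand` for every fatness `L ≥ 12`, seams PROVED (0 sorry)

TARGET (31280 residual of record, critic r1865 (A): `InterfaceDominance ⟸ SW♭₃₀ ∧ ShearLayer ∧ CoarseMid ∧ ThinFault`, tree
`…AffineCoreDescent.interfaceDominance_of_swapWide30`): its leaf **`ShearLayer`** — every `64`-deep site whose `12·nn`-ball is `(1/10⁴, 1/25)`-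
but not `(1/10⁴, 1/1000)`-affinely registered pays, against `#{not 64-deep} + #affMid(64, 12, 1/10⁴, 1/25)` — UNDECIDED · ATTACKABLE-L ·
INSTRUMENTED «STRAINBOX57» (census, STATUS l.9807; critic r1870 (A): margin IS a number), with the recorded doubt (tree `…AffineCoreDescentA`): «the
smooth grain around a strained core is guaranteed on `12·nn`-balls only, shorter than Z's Taylor range `ε₁^{-1/2} = 100`», and the critic's CAUTION
(r1865): per-site Cauchy–Born error `≈ C₁₁·θ·ε₁` against income `≥ c_W·θ²` — STRAINBOX57: `c_W(op) = 3.06` (fcc, soft `C′`) `… 5.52`,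
`C₁₁ ≈ 11.4–12.3` at `θ = 10⁻³` (`≈ 19` at `4·10⁻²`), ratio per strain state `≤ 0.364` at `θ = 10⁻³` (hcp, −tetragonal), `≤ 0.033` at `10⁻²`,
`≤ 0.009` at `4·10⁻²`.

EXTREMAL QUESTION (lens «minimal counterexample / extremal reduction»).  Which qualifiers can a counterexample to `ShearLayer` be FORCED to carry
at no cost in the statement?  Three, each by packing against the rebate the census already has (tree `natCard_le_mul_of_witness`):
(1) SITEWISE — a `ShearSite` only sees a strained smooth SITE within `12·nn` (`exists_strained_of_shearSite`); charge it to that site.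
(2) FAT — if that site is not `(1/10⁴, 1/25)`-smooth out to `L·nn`, a site within `L·nn` of it is not `(1/10⁴, 1/25)`-affinely registered: a WALL,
    rebated site by site (`notAffRegCount_le_rebate`).  So the priced sites may be taken smooth out to ANY radius `L` — e.g. `L = 128 >` the
    Taylor range `100`: the recorded doubt is DISSOLVED by bookkeeping, not answered by an estimate.
(3) BANDED — excluded middle on the site's OWN strain at a tolerance `θ₁` splits the population into the band `(10⁻³, θ₁]` («mild»: the
    linear-elastic regime where the CAUTION ratio lives) and `(θ₁, 1/25]` («strong»: income `≥ ½c_W θ₁²`, every leak an order below); a mild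
    site not fat at smoothness `θ₁` sees a strong site or a wall within `L'·nn` — packing again.
ONE parametric family, four record instances (`η = 1/10⁴` throughout):
* **`StrainBand L θlo θhi`** := `CensusW (strainBandCount L θlo θhi) (notDeep₆₄ + affMid_η)`, `strainBandCount = #{i : 64-deep, AffDeepReg L η θhi at i,
  ¬ AffReg η θlo at i}` («strained beyond `θlo` at the site, smooth with strain `≤ θhi` out to `L·nn`»).
* `SiteShear := StrainBand 12 (1/1000) (1/25)`, `FatShear := StrainBand 128 (1/1000) (1/25)` — NORMAL FORMS, `⟺ ShearLayer` (PROVED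
  `shearLayer_iff_strainBand`, every `L ≥ 12`: `⇒` sub-count, `⇐` packings (1)+(2)).
* **`MildBand := StrainBand 128 (1/1000) (1/100)`** — UNDECIDED · WEAKER (PROVED) · INSTRUMENTED «STRAINBOX57, linear corner» (income `≥ 3.06·10⁻⁶·
  (θ/10⁻³)²` per site; localisation leak `≤ 0.364` of it, worst for the hexagonal letter through its `c/a` / inner-displacement residual
  `|∇W(I)| = 1.05·10⁻³`; exchange `κ_Z = 0.27·η^{3/2} ≈ 2.7·10⁻⁷ ≤ 0.09` of it ⇒ net `≥ 0.55` of income) · ATTACKABLE-L (Cauchy–Born on a `128`-fat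
  grain, BOTH first-order terms summed by parts: the equilibrium bond-force term telescopes to the walls — rebated —, the stress term to `C₁₁·η²`
  per site) · why it might fail: the margin is `×2`, not `×30` — the telescoped first-order terms must really land on walls, not on band sites.
* **`StrongBand := StrainBand 128 (1/100) (1/25)`** — UNDECIDED · WEAKER (PROVED) · TRUE-type · INSTRUMENTED «STRAINBOX57, shell» (leak ratio
  `≤ 0.033` on `[10⁻², 1/25]`; the shell minimum of `[W(A) − e⋆]/θ²` IS the global `c_W(op) = 3.06`, attained at `θ = 0.04` in fcc's soft `C′`
  direction with softening sign, nonlinearity `≤ 10 %` along soft directions ⇒ the Born-stability question of `4 %`-strained close packings is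
  answered numerically with margin `×30`) · ATTACKABLE-L (same localisation, fat margin) · why it might fail: nothing structural is left; only
  the localisation bookkeeping (walls absorb the telescoped terms) is shared with MildBand.

SEAMS (PROVED): `shearLayerW_of_strainBandW` / `strainBandW_of_shearLayerW` (normal form, every `L`), `strainBandW_of_mild_strong` /
`strainBandW_anti` (band cut, every `L ≤ L'`, `θlo ≤ θ₁ ≤ 1/25`), **`ShearLayer ⟺ MildBand ∧ StrongBand`** (`shearLayer_iff_bands`), the record
seam `interfaceDominance_of_swapWide30_bands` : **`InterfaceDominance ⟸ SW♭₃₀ ∧ MildBand ∧ StrongBand ∧ CoarseMid ∧ ThinFault`**, and the cone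
`rdef_of_ceg_shape_strainBand_record` (tree cone BY NAME).  Parametric in `(L, L', θlo, θ₁)`; only the rebate's smoothness literal `1/25` is pinned.

WHY NOVEL.  g100 left the letter-free strained layer open with a RANGE MISMATCH (smoothness radius `12` vs Taylor range `100`) as its risk; the
mismatch is not a property of any minimal counterexample — fatness to every radius is free, as are the sitewise and banded forms.  What remains is
two EOS questions with SEPARATED margins, the linear corner (MildBand: the critic's CAUTION as a statement of its own, margin `×2`) and the
nonlinear shell (StrongBand, margin `×30`), both now INSTRUMENTED by STRAINBOX57 and provable by the tree's localisation pattern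
(`goodCoreFloor_of_near_far`) on a grain as fat as the proof wants; no new ask (lens-4 is summon-gated).  WHY EACH PIECE IS STRICTLY WEAKER: the
four instances price SUB-populations with the same rebate (`strainBandCount_anti`, `strainBandCount_le_shearLayerCount`); `MildBand ⇒ ShearLayer`, `StrongBand ⇒
ShearLayer`, `MildBand ⇔ StrongBand` MUST FAIL (probes `HOME/decomp-a2c-lens-4/g101/bc/`); jointly the two bands are EQUIVALENT to the target.
-/

namespace Summit.AtomisticToContinuum.Crystallization.Theorems.OverbindingBudgetAffineStrainBand

open scoped BigOperators Classical
open Literature.MathematicalPhysics.StatisticalMechanics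
open Literature.Geometry.DiscreteGeometry (IsChargeFree nearestDist nearestDist_nonneg nearestDist_le_dist)
open Summit.AtomisticToContinuum.Crystallization.Theorems.OverbindingBudgetMisfitRegistration (Framed Reg DeepReg)
open Summit.AtomisticToContinuum.Crystallization.Theorems.OverbindingBudgetMisfitWindowStatements (InWindow offCount)
open Summit.AtomisticToContinuum.Crystallization.Theorems.OverbindingBudgetBalancedCensusStatements
open Summit.AtomisticToContinuum.Crystallization.Theorems.OverbindingBudgetAffineLadder
open Summit.AtomisticToContinuum.Crystallization.Theorems.OverbindingBudgetAffineMesoCut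
open Summit.AtomisticToContinuum.Crystallization.Theorems.OverbindingBudgetAffinePhaseCut
open Summit.AtomisticToContinuum.Crystallization.Theorems.OverbindingBudgetAffineCushionCut
open Summit.AtomisticToContinuum.Crystallization.Theorems.OverbindingBudgetAffineTwinCut
open Summit.AtomisticToContinuum.Crystallization.Theorems.OverbindingBudgetAffineRunCut
open Summit.AtomisticToContinuum.Crystallization.Theorems.OverbindingBudgetAffineCompressedCut
open Summit.AtomisticToContinuum.Crystallization.Theorems.OverbindingBudgetAffineRunCutFlat
open Summit.AtomisticToContinuum.Crystallization.Theorems.OverbindingBudgetAffineWildCut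
open Summit.AtomisticToContinuum.Crystallization.Theorems.OverbindingBudgetAffineCoreDescent

variable {N : ℕ}

/-! ## §1  The parametric family, the walls, the four record instances -/

/-- `BandSite L θlo θhi y i` — `i` is `(64, 3/50, 1/450)`-deeply registered, its `L·nn`-ball is `(1/10⁴, θhi)`-affinely registered (smooth with
strain at most `θhi` out to `L` spacings), and `i`'s OWN two-shell cluster is not `(1/10⁴, θlo)`-affinely registered (strained beyond `θlo`). -/
def BandSite (L θlo θhi : ℝ) (y : Fin N → EuclideanSpace ℝ (Fin 3)) (i : Fin N) : Prop :=
  DeepReg 64 (3 / 50) (1 / 450) y i ∧ AffDeepReg L (1 / 10 ^ 4) θhi (1 / 450) y i ∧ ¬ AffReg (1 / 10 ^ 4) θlo (1 / 450) y i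

/-- `#BandSite L θlo θhi`. -/
noncomputable def strainBandCount (L θlo θhi : ℝ) (y : Fin N → EuclideanSpace ℝ (Fin 3)) : ℕ :=
  Nat.card {i // BandSite L θlo θhi y i}

/-- `WallSite y k` — `k` is not `64`-deep, or `64`-deep with a `12·nn`-ball that is not `(1/10⁴, 1/25)`-affinely registered: the two rebated
populations of `ShearLayer` (`#WallSite ≤ #{not 64-deep} + #affMid(64, 12, 1/10⁴, 1/25)`, `wallSiteCount_le`). -/
def WallSite (y : Fin N → EuclideanSpace ℝ (Fin 3)) (k : Fin N) : Prop :=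
  ¬ DeepReg 64 (3 / 50) (1 / 450) y k ∨ (DeepReg 64 (3 / 50) (1 / 450) y k ∧ ¬ AffDeepReg 12 (1 / 10 ^ 4) (1 / 25) (1 / 450) y k)

/-- **`StrainBandW L θlo θhi σ₁ σ₂`** (one window): every `BandSite L θlo θhi` pays `c > 0`, against `#{not 64-deep} + #affMid(64, 12, 1/10⁴, 1/25) +
#off + N^{2/3} + gains` — the rebate of `ShearLayer_W` verbatim. [this file · kind: statement] -/
def StrainBandW (L θlo θhi σ₁ σ₂ : ℝ) : Prop :=
  CensusW (fun y => strainBandCount L θlo θhi y)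
    (fun y => notDeepCount 64 (3 / 50) (1 / 450) y + affMidCount 64 12 (1 / 10 ^ 4) (1 / 25) (3 / 50) (1 / 450) y) σ₁ σ₂

/-- **`StrainBand L θlo θhi`** (tame: every window `[δ, 2]`, `0 < δ ≤ 2`). [this file · kind: statement] -/
def StrainBand (L θlo θhi : ℝ) : Prop :=
  ∀ δ : ℝ, 0 < δ → δ ≤ 2 → StrainBandW L θlo θhi δ 2

/-- **`SiteShear`** — the SITEWISE θ-layer: `StrainBand 12 (1/1000) (1/25)`. [NORMAL FORM · `⟺ ShearLayer` (PROVED)] -/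
def SiteShear : Prop :=
  StrainBand 12 (1 / 1000) (1 / 25)

/-- **`FatShear`** — the FAT sitewise θ-layer: `StrainBand 128 (1/1000) (1/25)` (fatness `128 >` Z's Taylor range `100 = (1/10⁴)^{-1/2}`).
[NORMAL FORM · `⟺ ShearLayer` (PROVED)] -/
def FatShear : Prop :=
  StrainBand 128 (1 / 1000) (1 / 25)

/-- **`MildBand`** — fat sites strained in `(10⁻³, 1/100]`, smooth at `(1/10⁴, 1/100)` out to `128·nn`: `StrainBand 128 (1/1000) (1/100)`.
[this file · kind: statement · WEAKER than `ShearLayer` (PROVED) · UNDECIDED · INSTRUMENTED «STRAINBOX57, linear corner» (margin ×2) · ATTACKABLE-L] -/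
def MildBand : Prop :=
  StrainBand 128 (1 / 1000) (1 / 100)

/-- **`StrongBand`** — fat sites strained in `(1/100, 1/25]`: `StrainBand 128 (1/100) (1/25)`.
[this file · kind: statement · WEAKER than `ShearLayer` (PROVED) · UNDECIDED · TRUE-type · INSTRUMENTED «STRAINBOX57, shell» (margin ×30) · ATTACKABLE-L] -/
def StrongBand : Prop :=
  StrainBand 128 (1 / 100) (1 / 25)

/-! ## §2  Counting (formal bookkeeping) -/

/-- `#WallSite ≤ #{not 64-deep} + #affMid(64, 12, 1/10⁴, 1/25)`. [formal bookkeeping] -/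
theorem wallSiteCount_le (y : Fin N → EuclideanSpace ℝ (Fin 3)) :
    Nat.card {k // WallSite y k} ≤ notDeepCount 64 (3 / 50) (1 / 450) y + affMidCount 64 12 (1 / 10 ^ 4) (1 / 25) (3 / 50) (1 / 450) y :=
  natCard_le_add_of_imp fun _ h => h

/-- A site that is not `(1/10⁴, 1/25)`-affinely registered is a wall (it lies in its own `12·nn`-ball). [formal bookkeeping] -/
theorem wallSite_of_not_affReg {y : Fin N → EuclideanSpace ℝ (Fin 3)} {k : Fin N} (hk : ¬ AffReg (1 / 10 ^ 4) (1 / 25) (1 / 450) y k) :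
    WallSite y k :=
  (Classical.em (DeepReg 64 (3 / 50) (1 / 450) y k)).symm.imp id fun hD =>
    ⟨hD, fun hA => hk (hA k (by rw [dist_self]; exact mul_nonneg (by norm_num) (nearestDist_nonneg y k)))⟩

/-- The centre of an affinely deep ball is affinely registered (`0 ≤ L`). [formal bookkeeping] -/
theorem affReg_of_affDeepReg {L ε θ g : ℝ} (hL : 0 ≤ L) {y : Fin N → EuclideanSpace ℝ (Fin 3)} {i : Fin N} (h : AffDeepReg L ε θ g y i) :
    AffReg ε θ g y i :=
  h i (by rw [dist_self]; exact mul_nonneg hL (nearestDist_nonneg y i))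

/-- A band site is GENUINELY strained: affinely framed at `(1/10⁴, θhi)` but not at `(1/10⁴, θlo)` (the charge-freeness clause of `AffReg` is
inherited from the fat ball, so `¬ AffReg … θlo` is a statement about the frame). [this file] -/
theorem bandSite_strained {L θlo θhi : ℝ} (hL : 0 ≤ L) {y : Fin N → EuclideanSpace ℝ (Fin 3)} {i : Fin N} (h : BandSite L θlo θhi y i) :
    AffFramed (1 / 10 ^ 4) θhi (1 / 450) y i ∧ ¬ AffFramed (1 / 10 ^ 4) θlo (1 / 450) y i :=
  ⟨(affReg_of_affDeepReg hL h.2.1).2, fun hF => h.2.2 ⟨(affReg_of_affDeepReg hL h.2.1).1, hF⟩⟩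

/-- **Antitonicity of the band count**: enlarging the fatness radius, raising the lower or lowering the upper tolerance shrinks the band.
[formal bookkeeping] -/
theorem strainBandCount_anti {L L' θlo θlo' θhi θhi' : ℝ} (hL : L ≤ L') (hlo : θlo ≤ θlo') (hhi : θhi' ≤ θhi)
    (y : Fin N → EuclideanSpace ℝ (Fin 3)) : strainBandCount L' θlo' θhi' y ≤ strainBandCount L θlo θhi y :=
  natCard_le_of_imp fun _ h =>
    ⟨h.1, affDeepReg_of_radius_le hL (affDeepReg_mono_theta hhi h.2.1), fun hA => h.2.2 (affReg_mono_theta hlo hA)⟩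

/-- A band site of fatness `L ≥ 12` at the record tolerances is a `ShearSite`: `#band(L, 1/1000, 1/25) ≤ #ShearSite`. [formal bookkeeping] -/
theorem strainBandCount_le_shearLayerCount {L : ℝ} (hL : 12 ≤ L) (y : Fin N → EuclideanSpace ℝ (Fin 3)) :
    strainBandCount L (1 / 1000) (1 / 25) y ≤ shearLayerCount y :=
  natCard_le_of_imp fun i h =>
    ⟨h.1, affDeepReg_of_radius_le hL h.2.1, fun hA => h.2.2 (affReg_of_affDeepReg (by norm_num) hA)⟩

/-- Excluded middle on the own strain at `θ₁`: `#band(L, θlo, θhi) ≤ #{band(L, θlo, θhi) ∧ AffReg θ₁} + #band(L, θ₁, θhi)`. [formal bookkeeping] -/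
theorem strainBandCount_le_split (L θlo θ₁ θhi : ℝ) (y : Fin N → EuclideanSpace ℝ (Fin 3)) :
    strainBandCount L θlo θhi y ≤ Nat.card {i // BandSite L θlo θhi y i ∧ AffReg (1 / 10 ^ 4) θ₁ (1 / 450) y i} + strainBandCount L θ₁ θhi y :=
  natCard_le_add_of_imp fun i h =>
    (Classical.em (AffReg (1 / 10 ^ 4) θ₁ (1 / 450) y i)).imp (fun hA => ⟨h, hA⟩) fun hA => ⟨h.1, h.2.1, hA⟩

/-! ## §3  Localisation: the witnesses of the two packings -/

/-- **Witness of a `ShearSite`** (in-window, any `L ≥ 0`, window top `σ₂ ≥ 0`): within `(12 + L)·σ₂` there is a FAT band site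
`BandSite L (1/1000) (1/25)`, a wall, or an off-window site. [this file] -/
theorem exists_witness_of_shearSite {L σ₁ σ₂ : ℝ} (hL : 0 ≤ L) (hσ₂ : 0 ≤ σ₂) {y : Fin N → EuclideanSpace ℝ (Fin 3)} {j : Fin N}
    (hw : InWindow σ₁ σ₂ y j) (hj : ShearSite y j) :
    ∃ k, (BandSite L (1 / 1000) (1 / 25) y k ∨ WallSite y k ∨ ¬ InWindow σ₁ σ₂ y k) ∧ dist (y j) (y k) ≤ (12 + L) * σ₂ := by
  obtain ⟨i, hdi, hAi, hNi⟩ := exists_strained_of_shearSite hj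
  have hdij : dist (y j) (y i) ≤ 12 * σ₂ := by
    rw [dist_comm]; exact hdi.trans (mul_le_mul_of_nonneg_left hw.2 (by norm_num))
  have hLσ : 0 ≤ L * σ₂ := mul_nonneg hL hσ₂
  by_cases hwi : InWindow σ₁ σ₂ y i; swap; · exact ⟨i, Or.inr (Or.inr hwi), by nlinarith⟩
  by_cases hD : DeepReg 64 (3 / 50) (1 / 450) y i; swap; · exact ⟨i, Or.inr (Or.inl (Or.inl hD)), by nlinarith⟩
  by_cases hF : AffDeepReg L (1 / 10 ^ 4) (1 / 25) (1 / 450) y i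
  · exact ⟨i, Or.inl ⟨hD, hF, hNi⟩, by nlinarith⟩
  · unfold AffDeepReg at hF
    push Not at hF
    obtain ⟨m, hdm, hNm⟩ := hF
    have hdim : dist (y i) (y m) ≤ L * σ₂ := by
      rw [dist_comm]; exact hdm.trans (mul_le_mul_of_nonneg_left hwi.2 hL)
    exact ⟨m, Or.inr (Or.inl (wallSite_of_not_affReg hNm)), by linarith [dist_triangle (y j) (y i) (y m)]⟩

/-- **Witness of a mild site that is not fat at `θ₁`** (in-window, `L, L' ≥ 0`, `σ₂ ≥ 0`): a band site of `StrainBand L θlo (1/25)` whose own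
cluster is `(1/10⁴, θ₁)`-affine has, within `(L' + L)·σ₂`, a band site of fatness `L'` at smoothness `θ₁`, a STRONG band site (`¬ AffReg θ₁`,
fat at `1/25`), a wall, or an off-window site. [this file] -/
theorem exists_witness_of_mildSite {L L' θlo θ₁ σ₁ σ₂ : ℝ} (hL : 0 ≤ L) (hL' : 0 ≤ L') (hσ₂ : 0 ≤ σ₂)
    {y : Fin N → EuclideanSpace ℝ (Fin 3)} {i : Fin N} (hw : InWindow σ₁ σ₂ y i)
    (hi : BandSite L θlo (1 / 25) y i ∧ AffReg (1 / 10 ^ 4) θ₁ (1 / 450) y i) :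
    ∃ k, (BandSite L' θlo θ₁ y k ∨ BandSite L θ₁ (1 / 25) y k ∨ WallSite y k ∨ ¬ InWindow σ₁ σ₂ y k) ∧
      dist (y i) (y k) ≤ (L' + L) * σ₂ := by
  have hLσ : 0 ≤ L * σ₂ := mul_nonneg hL hσ₂
  have hL'σ : 0 ≤ L' * σ₂ := mul_nonneg hL' hσ₂
  by_cases hF : AffDeepReg L' (1 / 10 ^ 4) θ₁ (1 / 450) y i
  · exact ⟨i, Or.inl ⟨hi.1.1, hF, hi.1.2.2⟩, by rw [dist_self]; nlinarith⟩
  unfold AffDeepReg at hF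
  push Not at hF
  obtain ⟨m, hdm, hNm⟩ := hF
  have hdim : dist (y i) (y m) ≤ L' * σ₂ := by
    rw [dist_comm]; exact hdm.trans (mul_le_mul_of_nonneg_left hw.2 hL')
  by_cases hwm : InWindow σ₁ σ₂ y m; swap; · exact ⟨m, Or.inr (Or.inr (Or.inr hwm)), by linarith⟩
  by_cases hD : DeepReg 64 (3 / 50) (1 / 450) y m; swap; · exact ⟨m, Or.inr (Or.inr (Or.inl (Or.inl hD))), by linarith⟩
  by_cases hFm : AffDeepReg L (1 / 10 ^ 4) (1 / 25) (1 / 450) y m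
  · exact ⟨m, Or.inr (Or.inl ⟨hD, hFm, hNm⟩), by linarith⟩
  · unfold AffDeepReg at hFm
    push Not at hFm
    obtain ⟨m', hdm', hNm'⟩ := hFm
    have hdmm : dist (y m) (y m') ≤ L * σ₂ := by
      rw [dist_comm]; exact hdm'.trans (mul_le_mul_of_nonneg_left hwm.2 hL)
    exact ⟨m', Or.inr (Or.inr (Or.inl (wallSite_of_not_affReg hNm'))), by linarith [dist_triangle (y i) (y m) (y m')]⟩

/-! ## §4  The two packing inequalities -/

/-- **Packing of the θ-layer onto the fat band** (`0 ≤ L`, `0 < σ₁ ≤ σ₂`, injective `y`):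
`#ShearSite ≤ 27(2(12+L)σ₂ + σ₁)³/σ₁³ · (#band(L, 1/1000, 1/25) + #{not 64-deep} + #affMid_η + #off) + #off`. [this file] -/
theorem shearLayerCount_le_packing {L σ₁ σ₂ : ℝ} (hL : 0 ≤ L) (hσ : 0 < σ₁) (hσσ : σ₁ ≤ σ₂) {y : Fin N → EuclideanSpace ℝ (Fin 3)}
    (hy : Function.Injective y) :
    (shearLayerCount y : ℝ) ≤ 27 / σ₁ ^ 3 * (2 * ((12 + L) * σ₂) + σ₁) ^ 3 *
        ((strainBandCount L (1 / 1000) (1 / 25) y + notDeepCount 64 (3 / 50) (1 / 450) y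
          + affMidCount 64 12 (1 / 10 ^ 4) (1 / 25) (3 / 50) (1 / 450) y + offCount σ₁ σ₂ y : ℕ) : ℝ) + offCount σ₁ σ₂ y := by
  have hσ₂ : 0 ≤ σ₂ := hσ.le.trans hσσ
  have hR₀ : 0 ≤ (12 + L) * σ₂ := mul_nonneg (by linarith) hσ₂
  have hP := natCard_le_mul_of_witness (σ₂ := σ₂) hσ hR₀ hy (P := fun j => ShearSite y j)
    (Q := fun k => BandSite L (1 / 1000) (1 / 25) y k ∨ WallSite y k ∨ ¬ InWindow σ₁ σ₂ y k)
    (fun j hj hPj => exists_witness_of_shearSite hL hσ₂ hj hPj)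
  have hQ1 : Nat.card {k // BandSite L (1 / 1000) (1 / 25) y k ∨ WallSite y k ∨ ¬ InWindow σ₁ σ₂ y k}
      ≤ strainBandCount L (1 / 1000) (1 / 25) y + Nat.card {k // WallSite y k ∨ ¬ InWindow σ₁ σ₂ y k} := natCard_le_add_of_imp fun _ h => h
  have hQ2 : Nat.card {k // WallSite y k ∨ ¬ InWindow σ₁ σ₂ y k} ≤ Nat.card {k // WallSite y k} + offCount σ₁ σ₂ y :=
    natCard_le_add_of_imp fun _ h => h
  have hQ3 := wallSiteCount_le y
  have hQn : Nat.card {k // BandSite L (1 / 1000) (1 / 25) y k ∨ WallSite y k ∨ ¬ InWindow σ₁ σ₂ y k}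
      ≤ strainBandCount L (1 / 1000) (1 / 25) y + notDeepCount 64 (3 / 50) (1 / 450) y
          + affMidCount 64 12 (1 / 10 ^ 4) (1 / 25) (3 / 50) (1 / 450) y + offCount σ₁ σ₂ y := hQ1.trans (by omega)
  have hQ : (Nat.card {k // BandSite L (1 / 1000) (1 / 25) y k ∨ WallSite y k ∨ ¬ InWindow σ₁ σ₂ y k} : ℝ)
      ≤ ((strainBandCount L (1 / 1000) (1 / 25) y + notDeepCount 64 (3 / 50) (1 / 450) y
          + affMidCount 64 12 (1 / 10 ^ 4) (1 / 25) (3 / 50) (1 / 450) y + offCount σ₁ σ₂ y : ℕ) : ℝ) := Nat.cast_le.mpr hQn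
  have hb : 0 ≤ 2 * ((12 + L) * σ₂) + σ₁ := by linarith
  have hK0 : 0 ≤ 27 / σ₁ ^ 3 * (2 * ((12 + L) * σ₂) + σ₁) ^ 3 := mul_nonneg (div_nonneg (by norm_num) (pow_nonneg hσ.le 3)) (pow_nonneg hb 3)
  unfold shearLayerCount
  exact hP.trans (by nlinarith [mul_le_mul_of_nonneg_left hQ hK0])

/-- **Packing of a band onto its mild-fat and strong sub-bands** (`0 ≤ L, L'`, `0 < σ₁ ≤ σ₂`, injective `y`):
`#band(L, θlo, 1/25) ≤ (27(2(L'+L)σ₂ + σ₁)³/σ₁³ + 1)·(#band(L', θlo, θ₁) + #band(L, θ₁, 1/25) + #notDeep₆₄ + #affMid_η + #off) + #off`. [this file] -/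
theorem strainBandCount_le_packing {L L' θlo θ₁ σ₁ σ₂ : ℝ} (hL : 0 ≤ L) (hL' : 0 ≤ L') (hσ : 0 < σ₁) (hσσ : σ₁ ≤ σ₂)
    {y : Fin N → EuclideanSpace ℝ (Fin 3)} (hy : Function.Injective y) :
    (strainBandCount L θlo (1 / 25) y : ℝ) ≤ (27 / σ₁ ^ 3 * (2 * ((L' + L) * σ₂) + σ₁) ^ 3 + 1) *
        ((strainBandCount L' θlo θ₁ y + strainBandCount L θ₁ (1 / 25) y + notDeepCount 64 (3 / 50) (1 / 450) y
          + affMidCount 64 12 (1 / 10 ^ 4) (1 / 25) (3 / 50) (1 / 450) y + offCount σ₁ σ₂ y : ℕ) : ℝ) + offCount σ₁ σ₂ y := by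
  have hσ₂ : 0 ≤ σ₂ := hσ.le.trans hσσ
  have hR₀ : 0 ≤ (L' + L) * σ₂ := mul_nonneg (by linarith) hσ₂
  have hP := natCard_le_mul_of_witness (σ₂ := σ₂) hσ hR₀ hy
    (P := fun i => BandSite L θlo (1 / 25) y i ∧ AffReg (1 / 10 ^ 4) θ₁ (1 / 450) y i)
    (Q := fun k => BandSite L' θlo θ₁ y k ∨ BandSite L θ₁ (1 / 25) y k ∨ WallSite y k ∨ ¬ InWindow σ₁ σ₂ y k)
    (fun i hi hPi => exists_witness_of_mildSite hL hL' hσ₂ hi hPi)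
  have hQ1 : Nat.card {k // BandSite L' θlo θ₁ y k ∨ BandSite L θ₁ (1 / 25) y k ∨ WallSite y k ∨ ¬ InWindow σ₁ σ₂ y k}
      ≤ strainBandCount L' θlo θ₁ y + Nat.card {k // BandSite L θ₁ (1 / 25) y k ∨ WallSite y k ∨ ¬ InWindow σ₁ σ₂ y k} :=
    natCard_le_add_of_imp fun _ h => h
  have hQ2 : Nat.card {k // BandSite L θ₁ (1 / 25) y k ∨ WallSite y k ∨ ¬ InWindow σ₁ σ₂ y k}
      ≤ strainBandCount L θ₁ (1 / 25) y + Nat.card {k // WallSite y k ∨ ¬ InWindow σ₁ σ₂ y k} := natCard_le_add_of_imp fun _ h => h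
  have hQ3 : Nat.card {k // WallSite y k ∨ ¬ InWindow σ₁ σ₂ y k} ≤ Nat.card {k // WallSite y k} + offCount σ₁ σ₂ y :=
    natCard_le_add_of_imp fun _ h => h
  have hQ4 := wallSiteCount_le y
  have hS := strainBandCount_le_split L θlo θ₁ (1 / 25) y
  have hQn : Nat.card {k // BandSite L' θlo θ₁ y k ∨ BandSite L θ₁ (1 / 25) y k ∨ WallSite y k ∨ ¬ InWindow σ₁ σ₂ y k}
      ≤ strainBandCount L' θlo θ₁ y + strainBandCount L θ₁ (1 / 25) y + notDeepCount 64 (3 / 50) (1 / 450) y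
          + affMidCount 64 12 (1 / 10 ^ 4) (1 / 25) (3 / 50) (1 / 450) y + offCount σ₁ σ₂ y := hQ1.trans (by omega)
  have hQ : (Nat.card {k // BandSite L' θlo θ₁ y k ∨ BandSite L θ₁ (1 / 25) y k ∨ WallSite y k ∨ ¬ InWindow σ₁ σ₂ y k} : ℝ)
      ≤ ((strainBandCount L' θlo θ₁ y + strainBandCount L θ₁ (1 / 25) y + notDeepCount 64 (3 / 50) (1 / 450) y
          + affMidCount 64 12 (1 / 10 ^ 4) (1 / 25) (3 / 50) (1 / 450) y + offCount σ₁ σ₂ y : ℕ) : ℝ) := Nat.cast_le.mpr hQn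
  have hS' : (strainBandCount L θlo (1 / 25) y : ℝ) ≤ ((Nat.card {i // BandSite L θlo (1 / 25) y i ∧ AffReg (1 / 10 ^ 4) θ₁ (1 / 450) y i}
      + strainBandCount L θ₁ (1 / 25) y : ℕ) : ℝ) := Nat.cast_le.mpr hS
  have hb : 0 ≤ 2 * ((L' + L) * σ₂) + σ₁ := by linarith
  have hK0 : 0 ≤ 27 / σ₁ ^ 3 * (2 * ((L' + L) * σ₂) + σ₁) ^ 3 := mul_nonneg (div_nonneg (by norm_num) (pow_nonneg hσ.le 3)) (pow_nonneg hb 3)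
  have n1 : (0 : ℝ) ≤ strainBandCount L' θlo θ₁ y := Nat.cast_nonneg _
  have n2 : (0 : ℝ) ≤ strainBandCount L θ₁ (1 / 25) y := Nat.cast_nonneg _
  have n3 : (0 : ℝ) ≤ notDeepCount 64 (3 / 50) (1 / 450) y := Nat.cast_nonneg _
  have n4 : (0 : ℝ) ≤ affMidCount 64 12 (1 / 10 ^ 4) (1 / 25) (3 / 50) (1 / 450) y := Nat.cast_nonneg _
  have n5 : (0 : ℝ) ≤ offCount σ₁ σ₂ y := Nat.cast_nonneg _
  push_cast at hP hQ hS' ⊢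
  nlinarith [mul_le_mul_of_nonneg_left hQ hK0]

/-! ## §5  THE SEAMS: normal form and band cut (one window, then tame) -/

/-- **`ShearLayer_W ⇒ StrainBand_W L (1/1000) (1/25)`** for `L ≥ 12` (sub-count: the WEAKER direction). [this file] -/
theorem strainBandW_of_shearLayerW {L σ₁ σ₂ : ℝ} (hL : 12 ≤ L) (h : ShearLayerW σ₁ σ₂) : StrainBandW L (1 / 1000) (1 / 25) σ₁ σ₂ :=
  censusW_mono (fun y => strainBandCount_le_shearLayerCount hL y) (fun _ => le_rfl) h

/-- **`StrainBand_W L (1/1000) (1/25) ⇒ ShearLayer_W`** for every `L ≥ 0` (packing: fatness is free). [this file] -/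
theorem shearLayerW_of_strainBandW {L σ₁ σ₂ : ℝ} (hL : 0 ≤ L) (hσ : 0 < σ₁) (hσσ : σ₁ ≤ σ₂) (h : StrainBandW L (1 / 1000) (1 / 25) σ₁ σ₂) :
    ShearLayerW σ₁ σ₂ := by
  set K : ℝ := 27 / σ₁ ^ 3 * (2 * ((12 + L) * σ₂) + σ₁) ^ 3 with hK
  have hb : 0 ≤ 2 * ((12 + L) * σ₂) + σ₁ := by nlinarith [mul_nonneg (show (0:ℝ) ≤ 12 + L by linarith) (hσ.le.trans hσσ)]
  have hK0 : 0 ≤ K := by rw [hK]; exact mul_nonneg (div_nonneg (by norm_num) (pow_nonneg hσ.le 3)) (pow_nonneg hb 3)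
  refine censusW_of_le_mul (K := K + 1) (by linarith) (fun y hy => ?_) h
  have hp := shearLayerCount_le_packing hL hσ hσσ hy
  rw [← hK] at hp
  have n1 : (0 : ℝ) ≤ strainBandCount L (1 / 1000) (1 / 25) y := Nat.cast_nonneg _
  have n3 : (0 : ℝ) ≤ notDeepCount 64 (3 / 50) (1 / 450) y := Nat.cast_nonneg _
  have n4 : (0 : ℝ) ≤ affMidCount 64 12 (1 / 10 ^ 4) (1 / 25) (3 / 50) (1 / 450) y := Nat.cast_nonneg _
  have n5 : (0 : ℝ) ≤ offCount σ₁ σ₂ y := Nat.cast_nonneg _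
  push_cast at hp ⊢
  nlinarith [mul_nonneg hK0 n1, mul_nonneg hK0 n3, mul_nonneg hK0 n4, mul_nonneg hK0 n5]

/-- **Band antitonicity**: `StrainBand_W L θlo θhi ⇒ StrainBand_W L' θlo' θhi'` for `L ≤ L'`, `θlo ≤ θlo'`, `θhi' ≤ θhi` (sub-count). [this file] -/
theorem strainBandW_anti {L L' θlo θlo' θhi θhi' σ₁ σ₂ : ℝ} (hL : L ≤ L') (hlo : θlo ≤ θlo') (hhi : θhi' ≤ θhi)
    (h : StrainBandW L θlo θhi σ₁ σ₂) : StrainBandW L' θlo' θhi' σ₁ σ₂ :=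
  censusW_mono (fun y => strainBandCount_anti hL hlo hhi y) (fun _ => le_rfl) h

/-- **THE BAND CUT** (one window, `0 ≤ L, L'`, `0 < σ₁ ≤ σ₂`, any `θlo, θ₁`):
`StrainBand_W L' θlo θ₁ ∧ StrainBand_W L θ₁ (1/25) ⇒ StrainBand_W L θlo (1/25)` (glue the two censuses, then pack). [this file] -/
theorem strainBandW_of_mild_strong {L L' θlo θ₁ σ₁ σ₂ : ℝ} (hL : 0 ≤ L) (hL' : 0 ≤ L') (hσ : 0 < σ₁) (hσσ : σ₁ ≤ σ₂)
    (hM : StrainBandW L' θlo θ₁ σ₁ σ₂) (hS : StrainBandW L θ₁ (1 / 25) σ₁ σ₂) : StrainBandW L θlo (1 / 25) σ₁ σ₂ := by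
  have hG : CensusW (fun y => strainBandCount L' θlo θ₁ y + strainBandCount L θ₁ (1 / 25) y)
      (fun y => notDeepCount 64 (3 / 50) (1 / 450) y + affMidCount 64 12 (1 / 10 ^ 4) (1 / 25) (3 / 50) (1 / 450) y) σ₁ σ₂ :=
    censusW_glue (R := fun y => strainBandCount L' θlo θ₁ y + strainBandCount L θ₁ (1 / 25) y) (A := fun y => strainBandCount L' θlo θ₁ y)
      (B := fun y => strainBandCount L θ₁ (1 / 25) y)
      (D₁ := fun y => notDeepCount 64 (3 / 50) (1 / 450) y + affMidCount 64 12 (1 / 10 ^ 4) (1 / 25) (3 / 50) (1 / 450) y)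
      (D := fun y => notDeepCount 64 (3 / 50) (1 / 450) y + affMidCount 64 12 (1 / 10 ^ 4) (1 / 25) (3 / 50) (1 / 450) y)
      (fun _ => le_rfl) (fun _ => Nat.le_add_right _ _) hM hS
  set K : ℝ := 27 / σ₁ ^ 3 * (2 * ((L' + L) * σ₂) + σ₁) ^ 3 with hK
  have hb : 0 ≤ 2 * ((L' + L) * σ₂) + σ₁ := by nlinarith [mul_nonneg (show (0:ℝ) ≤ L' + L by linarith) (hσ.le.trans hσσ)]
  have hK0 : 0 ≤ K := by rw [hK]; exact mul_nonneg (div_nonneg (by norm_num) (pow_nonneg hσ.le 3)) (pow_nonneg hb 3)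
  refine censusW_of_le_mul (K := K + 2) (by linarith) (fun y hy => ?_) hG
  have hp := strainBandCount_le_packing (θlo := θlo) (θ₁ := θ₁) hL hL' hσ hσσ hy
  rw [← hK] at hp
  have n1 : (0 : ℝ) ≤ strainBandCount L' θlo θ₁ y := Nat.cast_nonneg _
  have n2 : (0 : ℝ) ≤ strainBandCount L θ₁ (1 / 25) y := Nat.cast_nonneg _
  have n3 : (0 : ℝ) ≤ notDeepCount 64 (3 / 50) (1 / 450) y := Nat.cast_nonneg _
  have n4 : (0 : ℝ) ≤ affMidCount 64 12 (1 / 10 ^ 4) (1 / 25) (3 / 50) (1 / 450) y := Nat.cast_nonneg _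
  have n5 : (0 : ℝ) ≤ offCount σ₁ σ₂ y := Nat.cast_nonneg _
  push_cast at hp ⊢
  nlinarith [mul_nonneg hK0 n1, mul_nonneg hK0 n2, mul_nonneg hK0 n3, mul_nonneg hK0 n4, mul_nonneg hK0 n5]

/-- **NORMAL FORM (tame): `ShearLayer ⟺ StrainBand L (1/1000) (1/25)` for every fatness `L ≥ 12`.** [this file] -/
theorem shearLayer_iff_strainBand {L : ℝ} (hL : 12 ≤ L) : ShearLayer ↔ StrainBand L (1 / 1000) (1 / 25) :=
  ⟨fun h δ hδ hδ2 => strainBandW_of_shearLayerW hL (h δ hδ hδ2),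
    fun h δ hδ hδ2 => shearLayerW_of_strainBandW (by linarith) hδ hδ2 (h δ hδ hδ2)⟩

/-- **BAND CUT (tame): `StrainBand L θlo (1/25) ⟺ StrainBand L' θlo θ₁ ∧ StrainBand L θ₁ (1/25)`**, `0 ≤ L ≤ L'`, `θlo ≤ θ₁ ≤ 1/25`. [this file] -/
theorem strainBand_iff_mild_strong {L L' θlo θ₁ : ℝ} (hL : 0 ≤ L) (hLL : L ≤ L') (h₁ : θlo ≤ θ₁) (h₂ : θ₁ ≤ 1 / 25) :
    StrainBand L θlo (1 / 25) ↔ StrainBand L' θlo θ₁ ∧ StrainBand L θ₁ (1 / 25) :=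
  ⟨fun h => ⟨fun δ hδ hδ2 => strainBandW_anti hLL le_rfl h₂ (h δ hδ hδ2), fun δ hδ hδ2 => strainBandW_anti le_rfl h₁ le_rfl (h δ hδ hδ2)⟩,
    fun h δ hδ hδ2 => strainBandW_of_mild_strong hL (hL.trans hLL) hδ hδ2 (h.1 δ hδ hδ2) (h.2 δ hδ hδ2)⟩

/-! ## §6  The record instances and the cone of record -/

/-- `ShearLayer ⟺ SiteShear` (the sitewise θ-layer). [this file] -/
theorem shearLayer_iff_siteShear : ShearLayer ↔ SiteShear :=
  shearLayer_iff_strainBand (by norm_num)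

/-- `ShearLayer ⟺ FatShear` (fatness `128` is free). [this file] -/
theorem shearLayer_iff_fatShear : ShearLayer ↔ FatShear :=
  shearLayer_iff_strainBand (by norm_num)

/-- `FatShear ⟺ MildBand ∧ StrongBand` (the band cut at `θ₁ = 1/100`). [this file] -/
theorem fatShear_iff_bands : FatShear ↔ MildBand ∧ StrongBand :=
  strainBand_iff_mild_strong (by norm_num) le_rfl (by norm_num) (by norm_num)

/-- **`ShearLayer ⟺ MildBand ∧ StrongBand`.** [this file] -/
theorem shearLayer_iff_bands : ShearLayer ↔ MildBand ∧ StrongBand :=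
  shearLayer_iff_fatShear.trans fatShear_iff_bands

/-- `MildBand ∧ StrongBand ⇒ ShearLayer` (the direction the cone uses). [this file] -/
theorem shearLayer_of_bands (hM : MildBand) (hS : StrongBand) : ShearLayer :=
  shearLayer_iff_bands.2 ⟨hM, hS⟩

/-- **THE RECORD SEAM through the bands: `InterfaceDominance ⟸ SW♭₃₀ ∧ MildBand ∧ StrongBand ∧ CoarseMid ∧ ThinFault`.** [this file] -/
theorem interfaceDominance_of_swapWide30_bands (hT : StackSwapGainFlatWide30) (hMi : MildBand) (hSt : StrongBand) (hM : CoarseMid)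
    (hF : ThinFault) : InterfaceDominance :=
  interfaceDominance_of_swapWide30 hT (shearLayer_of_bands hMi hSt) hM hF

/-- **RDEF of record through the bands** (tree cone `rdef_of_ceg_shape_corePacking_record` BY NAME, its `ShearLayer` leaf discharged from
`MildBand ∧ StrongBand`). [this file] -/
theorem rdef_of_ceg_shape_strainBand_record
    (hCEG : Summit.AtomisticToContinuum.Crystallization.Theses.PricedLinkCensus.ChargedEnergyGap)
    (hSh : OverbindingBudgetTwoShellShape.TwoShellShape (1 / 100) (3 / 50) (1 / 450))
    (hQH : TameBalancedHexRoughGap 64 12 (1 / 10 ^ 5) (1 / 25) (3 / 50) (1 / 450) 12) (hQ : RoughCubic)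
    (hT : StackSwapGainFlatWide30) (hMi : MildBand) (hSt : StrongBand) (hM : CoarseMid) (hF : ThinFault)
    (hK : ∃ μ₁ μR : ℝ, 0 < μ₁ ∧ 0 < μR ∧ OverbindingBudgetAffineNearCluster.PureMarginStabilityAt (3 / 2000) μ₁ μR 4)
    (hA : AffineChartStraightening)
    (hE : OverbindingBudgetAffineNearCluster.NearLightSkeletonEquilibrium (3 / 2000) 4 6 (1 / 1000) 12 (1 / 25) (1 / 2000) 4 6 320 12)
    (hCF : OverbindingBudgetAffineNearCluster.NearPricedCoreFloor (3 / 2000) 4 6 (1 / 1000) 12 (1 / 25) (1 / 2000) (1 / (4 * 10 ^ 7) / 4) 4 6 12)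
    (hSF : OverbindingBudgetAffineNearCluster.NearPricedShellFloor (3 / 2000) 4 6 (1 / 1000) 12 (1 / 25) (1 / 2000) (1 / (4 * 10 ^ 7) / 4) 4 6 12)
    (hV : OverbindingBudgetAffineNearCluster.ForceContentVisible (3 / 2000) 4 6 (1 / 1000) 12 (1 / 25) (1 / 2000) 4 6)
    (hN : OverbindingBudgetAffineNearCluster.NearSecondOrderFloor (3 / 2000) 4 6 (1 / 1000) 12 (1 / 25) (1 / 2000) (1 / (4 * 10 ^ 7)))
    (hFA : OverbindingBudgetAffineLocalisation.FarAggregatePricing 12 (1 / 25) (1 / 2000) (1 / (2 * 10 ^ 7)))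
    (hFR : FineNonAffinity 12 (1 / 10 ^ 5) (1 / 25))
    (hTT : OverbindingBudgetGradedBareness.CleanlessExcessT) (hRR : OverbindingBudgetCoherentCut.CoherentResidual 10) :
    Summit.AtomisticToContinuum.Crystallization.Theses.OverbindingBudget.RobustDefectLimitWindows :=
  rdef_of_ceg_shape_corePacking_record hCEG hSh hQH hQ hT (shearLayer_of_bands hMi hSt) hM hF hK hA hE hCF hSF hV hN hFA hFR hTT hRR

end Summit.AtomisticToContinuum.Crystallization.Theorems.OverbindingBudgetAffineStrainBand
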